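import Mathlib
import HarnessLib

/-!
# `DensityLadder.SeparatedTowerDensityLine` (item stmt-RiemannHypothesis-24918) — tame-family sums
# (unit-window log density ⇒ Gaussian local masses and decay-weighted global masses)

LINE L57 «sieve sight above the density line» (rh-idea-10 g1), crux K1 `SeparatedTowerDensityLine`
(stmt-RiemannHypothesis-24918), stub S1 `stub_separatedMeanValueCount` of the registered skeleton
`Birth.lean`, piece (T1) of the division of labour posted on the cell bus 2026-08-28T04:1xZ
(prover-l57b ↔ prover-l57).  Everything here is about an abstract real family `γ : J → ℝ` with
nonnegative masses `m : J → ℝ` whose UNIT WINDOWS have logarithmic mass,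
`Σ_{|γ_j − t| ≤ 1} m_j ≤ C log(|t| + 2)` (the «tame» = on-line part of the configuration of K1; the
g-separated tower satisfies the same hypothesis with `C = B(2/g+1)/log 2`).  We cover `ℝ` by the
width-2 windows `[t+2n−1, t+2n+1]`, `n = round((γ−t)/2) ∈ ℤ`, and prove:
* `tame_local_mass`: `Σ'_j m_j e^{−c(γ_j−t)²} ≤ A_c · C · log(|t|+2)` for every `t` (Gaussian local mass);
* `sum_window_le`: the window decomposition behind it (any window majorant `F ≥ 0` on `ℤ`).
The decay-weighted versions (global mass `Σ' m_j ω_j` and local mass `Σ' m_j ω_j e^{−c(γ_j−t)²}` for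
`ω_j ≤ min(W₀, W₁/γ_j²)`, i.e. `ω_j = ‖ĉ_j(η)‖`) are in the companion file
`DensityLadderSeparatedTowerTameDecay`.  Constants are existential (no new definitions).
Cell rh-split, seat rh-split-prover-l57b g0.  RH-free, ζ-free; FRONTIER bookkeeping (DH-capped);
nothing here bears on the truth of RH.
-/

set_option linter.dupNamespace false

noncomputable section

open Filter Set Topology

namespace Summit.RiemannHypothesis.RiemannHypothesis.Theorems.DensityLadderSeparatedTowerTame

/-! ## Width-2 windows -/

/-- `γ` lies in its window: `|γ − (t + 2n)| ≤ 1`. [folklore] -/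
theorem abs_sub_window_le (t γ : ℝ) :
    |γ - (t + 2 * ((round ((γ - t) / 2) : ℤ) : ℝ))| ≤ 1 := by
  have h := abs_sub_round ((γ - t) / 2)
  have e : γ - (t + 2 * ((round ((γ - t) / 2) : ℤ) : ℝ)) =
      2 * ((γ - t) / 2 - ((round ((γ - t) / 2) : ℤ) : ℝ)) := by ring
  rw [e, abs_mul, abs_two]
  linarith

/-- The window index is dominated by the distance to the centre: `n² ≤ (γ − t)²`. [folklore] -/
theorem sq_round_window_le (t γ : ℝ) :
    (((round ((γ - t) / 2) : ℤ) : ℝ)) ^ 2 ≤ (γ - t) ^ 2 := by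
  set n : ℤ := round ((γ - t) / 2) with hn
  by_cases h0 : n = 0
  · rw [h0]; simpa using sq_nonneg (γ - t)
  · have h := abs_sub_round ((γ - t) / 2)
    rw [← hn] at h
    have h1 : (1 : ℝ) ≤ |(n : ℝ)| := by
      rw [← Int.cast_abs]; exact_mod_cast Int.one_le_abs h0
    have h2 : |(n : ℝ)| ≤ |(γ - t) / 2| + 1 / 2 := by
      have := abs_sub_abs_le_abs_sub (n : ℝ) ((γ - t) / 2)
      rw [abs_sub_comm] at this
      linarith
    rw [abs_div, abs_two] at h2
    have h3 : |(n : ℝ)| ≤ |γ - t| := by linarith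
    calc ((n : ℝ)) ^ 2 = |(n : ℝ)| ^ 2 := (sq_abs _).symm
      _ ≤ |γ - t| ^ 2 := pow_le_pow_left₀ (abs_nonneg _) h3 2
      _ = (γ - t) ^ 2 := sq_abs _

/-- Gaussian comparison on a window: `e^{−c(γ−t)²} ≤ e^{−c n²}`. [folklore] -/
theorem exp_gauss_le_exp_index {c : ℝ} (hc : 0 ≤ c) (t γ : ℝ) :
    Real.exp (-(c * (γ - t) ^ 2)) ≤ Real.exp (-(c * (((round ((γ - t) / 2) : ℤ) : ℝ)) ^ 2)) := by
  rw [Real.exp_le_exp, neg_le_neg_iff]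
  exact mul_le_mul_of_nonneg_left (sq_round_window_le t γ) hc

/-- The window centres are not much farther out than `t`:
`log(|t+2n|+2) ≤ log(|t|+2) · (1 + log(2|n|+1)/log 2)`. [folklore] -/
theorem log_window_le (t : ℝ) (n : ℤ) :
    Real.log (|t + 2 * (n : ℝ)| + 2) ≤
      Real.log (|t| + 2) * (1 + Real.log (2 * |(n : ℝ)| + 1) / Real.log 2) := by
  have h2 : 0 < Real.log 2 := Real.log_pos (by norm_num)
  have ht : Real.log 2 ≤ Real.log (|t| + 2) :=
    Real.log_le_log (by norm_num) (by linarith [abs_nonneg t])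
  have hn0 : 0 ≤ Real.log (2 * |(n : ℝ)| + 1) :=
    Real.log_nonneg (by linarith [abs_nonneg (n : ℝ)])
  have hprod : |t + 2 * (n : ℝ)| + 2 ≤ (|t| + 2) * (2 * |(n : ℝ)| + 1) := by
    have := abs_add_le t (2 * (n : ℝ))
    rw [abs_mul, abs_two] at this
    nlinarith [abs_nonneg t, abs_nonneg (n : ℝ)]
  have key : Real.log (2 * |(n : ℝ)| + 1) ≤
      Real.log (|t| + 2) * (Real.log (2 * |(n : ℝ)| + 1) / Real.log 2) := by
    rw [mul_div_assoc', le_div_iff₀ h2]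
    calc Real.log (2 * |(n : ℝ)| + 1) * Real.log 2
        ≤ Real.log (2 * |(n : ℝ)| + 1) * Real.log (|t| + 2) := mul_le_mul_of_nonneg_left ht hn0
      _ = Real.log (|t| + 2) * Real.log (2 * |(n : ℝ)| + 1) := mul_comm _ _
  calc Real.log (|t + 2 * (n : ℝ)| + 2)
      ≤ Real.log ((|t| + 2) * (2 * |(n : ℝ)| + 1)) :=
        Real.log_le_log (by positivity) hprod
    _ = Real.log (|t| + 2) + Real.log (2 * |(n : ℝ)| + 1) :=
        Real.log_mul (by positivity) (by positivity)
    _ ≤ Real.log (|t| + 2) + Real.log (|t| + 2) * (Real.log (2 * |(n : ℝ)| + 1) / Real.log 2) := by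
        linarith
    _ = _ := by ring

/-! ## The comparison series over `ℤ` -/

/-- The Gaussian-log series `Σ_{k≥0} e^{−ck²}(1 + log(2k+1)/log 2)` converges (`c > 0`). [folklore] -/
theorem summable_gaussLog_nat {c : ℝ} (hc : 0 < c) :
    Summable fun k : ℕ ↦
      Real.exp (-(c * (k : ℝ) ^ 2)) * (1 + Real.log (2 * (k : ℝ) + 1) / Real.log 2) := by
  set r : ℝ := Real.exp (-c) with hr
  have hr0 : 0 ≤ r := (Real.exp_pos _).le
  have hr1 : r < 1 := Real.exp_lt_one_iff.mpr (by linarith)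
  have hnorm : ‖r‖ < 1 := by rw [Real.norm_eq_abs, abs_of_nonneg hr0]; exact hr1
  have h2 : 0 < Real.log 2 := Real.log_pos (by norm_num)
  have hs1 : Summable fun k : ℕ ↦ r ^ k := summable_geometric_of_lt_one hr0 hr1
  have hs2 : Summable fun k : ℕ ↦ (k : ℝ) ^ 1 * r ^ k :=
    summable_pow_mul_geometric_of_norm_lt_one 1 hnorm
  have hs3 : Summable fun k : ℕ ↦ r ^ k + 2 / Real.log 2 * ((k : ℝ) ^ 1 * r ^ k) :=
    hs1.add (hs2.mul_left _)
  refine Summable.of_nonneg_of_le (fun k ↦ ?_) (fun k ↦ ?_) hs3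
  · have : 0 ≤ Real.log (2 * (k : ℝ) + 1) := Real.log_nonneg (by linarith [Nat.cast_nonneg (α := ℝ) k])
    have : 0 ≤ Real.log (2 * (k : ℝ) + 1) / Real.log 2 := div_nonneg this h2.le
    positivity
  · have hk0 : (0 : ℝ) ≤ k := Nat.cast_nonneg k
    have hexp : Real.exp (-(c * (k : ℝ) ^ 2)) ≤ r ^ k := by
      rw [hr, ← Real.exp_nat_mul, Real.exp_le_exp]
      have hk : (k : ℝ) ≤ (k : ℝ) ^ 2 := by exact_mod_cast Nat.le_self_pow two_ne_zero k
      nlinarith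
    have hlog : Real.log (2 * (k : ℝ) + 1) ≤ 2 * k := by
      have := Real.log_le_sub_one_of_pos (show 0 < 2 * (k : ℝ) + 1 by linarith)
      linarith
    have hfac : 1 + Real.log (2 * (k : ℝ) + 1) / Real.log 2 ≤ 1 + 2 / Real.log 2 * k := by
      rw [show 2 / Real.log 2 * (k : ℝ) = (2 * k) / Real.log 2 by ring]
      have := div_le_div_of_nonneg_right hlog h2.le
      linarith
    have hfac0 : 0 ≤ 1 + Real.log (2 * (k : ℝ) + 1) / Real.log 2 := by
      have : 0 ≤ Real.log (2 * (k : ℝ) + 1) := Real.log_nonneg (by linarith)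
      have : 0 ≤ Real.log (2 * (k : ℝ) + 1) / Real.log 2 := div_nonneg this h2.le
      linarith
    calc Real.exp (-(c * (k : ℝ) ^ 2)) * (1 + Real.log (2 * (k : ℝ) + 1) / Real.log 2)
        ≤ r ^ k * (1 + 2 / Real.log 2 * k) :=
          mul_le_mul hexp hfac hfac0 (pow_nonneg hr0 k)
      _ = r ^ k + 2 / Real.log 2 * ((k : ℝ) ^ 1 * r ^ k) := by ring

/-- The same series over `ℤ` converges. [folklore] -/
theorem summable_gaussLog_int {c : ℝ} (hc : 0 < c) :
    Summable fun n : ℤ ↦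
      Real.exp (-(c * (n : ℝ) ^ 2)) * (1 + Real.log (2 * |(n : ℝ)| + 1) / Real.log 2) := by
  have h := summable_gaussLog_nat hc
  refine Summable.of_nat_of_neg ?_ ?_
  · refine h.congr fun k ↦ ?_
    simp only [Int.cast_natCast, Nat.abs_cast]
  · refine h.congr fun k ↦ ?_
    simp only [Int.cast_neg, Int.cast_natCast, even_two, Even.neg_pow, abs_neg, Nat.abs_cast]

/-- The terms of the `ℤ`-series are nonnegative, so its sum `A_c ≥ 0`. [folklore] -/
theorem tsum_gaussLog_int_nonneg (c : ℝ) :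
    0 ≤ ∑' n : ℤ, Real.exp (-(c * (n : ℝ) ^ 2)) * (1 + Real.log (2 * |(n : ℝ)| + 1) / Real.log 2) := by
  refine tsum_nonneg fun n ↦ ?_
  have h2 : 0 < Real.log 2 := Real.log_pos (by norm_num)
  have : 0 ≤ Real.log (2 * |(n : ℝ)| + 1) := Real.log_nonneg (by linarith [abs_nonneg (n : ℝ)])
  have : 0 ≤ Real.log (2 * |(n : ℝ)| + 1) / Real.log 2 := div_nonneg this h2.le
  positivity


/-! ## Window sums for a family with logarithmic unit-window mass -/

variable {J : Type}

/-- The unit-window hypothesis forces `C ≥ 0`. [folklore] -/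
theorem windowConst_nonneg (m : J → ℝ) (γ : J → ℝ) (hm : ∀ j, 0 ≤ m j) {C : ℝ}
    (hwin : ∀ t : ℝ, {j | |γ j - t| ≤ 1}.Finite ∧
      ∑ᶠ j ∈ {j | |γ j - t| ≤ 1}, m j ≤ C * Real.log (|t| + 2)) : 0 ≤ C := by
  have h := (hwin 0).2
  have h0 : 0 ≤ ∑ᶠ j ∈ {j | |γ j - 0| ≤ 1}, m j :=
    finsum_nonneg fun j ↦ finsum_nonneg fun _ ↦ hm j
  have hlog : 0 < Real.log (|(0 : ℝ)| + 2) := by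
    rw [abs_zero, zero_add]; exact Real.log_pos (by norm_num)
  by_contra hC
  have : C * Real.log (|(0 : ℝ)| + 2) < 0 := mul_neg_of_neg_of_pos (not_le.1 hC) hlog
  linarith

/-- **Window decomposition of a finite sum.**  If `F ≥ 0` on `ℤ` and
`Σ_n F(n) log(|t+2n|+2) < ∞`, then for every finite set `u` of indices
`Σ_{j∈u} m_j F(n_j) ≤ C Σ'_n F(n) log(|t+2n|+2)`, `n_j = round((γ_j−t)/2)` the window index of `γ_j` (group the sum by
windows; each window has mass `≤ C log(|centre|+2)`). [folklore] -/
theorem sum_window_le (m : J → ℝ) (γ : J → ℝ) (hm : ∀ j, 0 ≤ m j) {C : ℝ}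
    (hwin : ∀ t : ℝ, {j | |γ j - t| ≤ 1}.Finite ∧
      ∑ᶠ j ∈ {j | |γ j - t| ≤ 1}, m j ≤ C * Real.log (|t| + 2))
    (t : ℝ) {F : ℤ → ℝ} (hF0 : ∀ n, 0 ≤ F n)
    (hFs : Summable fun n : ℤ ↦ F n * Real.log (|t + 2 * (n : ℝ)| + 2)) (u : Finset J) :
    ∑ j ∈ u, m j * F (round ((γ j - t) / 2)) ≤
      C * ∑' n : ℤ, F n * Real.log (|t + 2 * (n : ℝ)| + 2) := by
  classical
  have hC := windowConst_nonneg m γ hm hwin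
  set nI : J → ℤ := fun j ↦ round ((γ j - t) / 2) with hnI
  have hmaps : ∀ j ∈ u, nI j ∈ u.image nI := fun j hj ↦ Finset.mem_image_of_mem nI hj
  rw [← Finset.sum_fiberwise_of_maps_to hmaps]
  have hfib : ∀ n ∈ u.image nI, ∑ j ∈ u.filter (fun j ↦ nI j = n), m j * F (nI j) ≤
      F n * (C * Real.log (|t + 2 * (n : ℝ)| + 2)) := by
    intro n _
    have e : ∑ j ∈ u.filter (fun j ↦ nI j = n), m j * F (nI j) =
        F n * ∑ j ∈ u.filter (fun j ↦ nI j = n), m j := by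
      rw [Finset.mul_sum]
      refine Finset.sum_congr rfl fun j hj ↦ ?_
      rw [Finset.mem_filter] at hj
      rw [hj.2, mul_comm]
    rw [e]
    refine mul_le_mul_of_nonneg_left ?_ (hF0 n)
    obtain ⟨hfin, hmass⟩ := hwin (t + 2 * (n : ℝ))
    refine le_trans ?_ hmass
    rw [finsum_mem_eq_finite_toFinset_sum _ hfin]
    refine Finset.sum_le_sum_of_subset_of_nonneg (fun j hj ↦ ?_) (fun j _ _ ↦ hm j)
    rw [Finset.mem_filter] at hj
    rw [Set.Finite.mem_toFinset, Set.mem_setOf_eq]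
    have h1 := abs_sub_window_le t (γ j)
    have h2 : round ((γ j - t) / 2) = n := hj.2
    rw [h2] at h1
    exact h1
  calc ∑ n ∈ u.image nI, ∑ j ∈ u.filter (fun j ↦ nI j = n), m j * F (nI j)
      ≤ ∑ n ∈ u.image nI, F n * (C * Real.log (|t + 2 * (n : ℝ)| + 2)) :=
        Finset.sum_le_sum hfib
    _ = C * ∑ n ∈ u.image nI, F n * Real.log (|t + 2 * (n : ℝ)| + 2) := by
        rw [Finset.mul_sum]; exact Finset.sum_congr rfl fun n _ ↦ by ring
    _ ≤ C * ∑' n : ℤ, F n * Real.log (|t + 2 * (n : ℝ)| + 2) := by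
        refine mul_le_mul_of_nonneg_left ?_ hC
        exact hFs.sum_le_tsum _ fun n _ ↦ mul_nonneg (hF0 n)
          (Real.log_nonneg (by linarith [abs_nonneg (t + 2 * (n : ℝ))]))

/-- **(T1.i) Gaussian local mass of a tame family**: if the unit windows of `(γ, m)` have mass
`≤ C log(|t|+2)`, then for `c > 0` and every `t`,
`Σ'_j m_j e^{−c(γ_j−t)²} ≤ A_c · C · log(|t|+2)` with
`A_c = Σ'_{n∈ℤ} e^{−cn²}(1 + log(2|n|+1)/log 2)`, and the family is summable. [folklore] -/
theorem tame_local_mass (m : J → ℝ) (γ : J → ℝ) (hm : ∀ j, 0 ≤ m j) {C : ℝ}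
    (hwin : ∀ t : ℝ, {j | |γ j - t| ≤ 1}.Finite ∧
      ∑ᶠ j ∈ {j | |γ j - t| ≤ 1}, m j ≤ C * Real.log (|t| + 2))
    {c : ℝ} (hc : 0 < c) :
    ∃ A : ℝ, 0 ≤ A ∧ ∀ t : ℝ,
      Summable (fun j ↦ m j * Real.exp (-(c * (γ j - t) ^ 2))) ∧
      ∑' j, m j * Real.exp (-(c * (γ j - t) ^ 2)) ≤ A * C * Real.log (|t| + 2) := by
  classical
  have hC := windowConst_nonneg m γ hm hwin
  refine ⟨∑' n : ℤ, Real.exp (-(c * (n : ℝ) ^ 2)) * (1 + Real.log (2 * |(n : ℝ)| + 1) / Real.log 2),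
    tsum_gaussLog_int_nonneg c, fun t ↦ ?_⟩
  set A : ℝ := ∑' n : ℤ, Real.exp (-(c * (n : ℝ) ^ 2)) *
    (1 + Real.log (2 * |(n : ℝ)| + 1) / Real.log 2) with hA
  set F : ℤ → ℝ := fun n ↦ Real.exp (-(c * (n : ℝ) ^ 2)) with hF
  have hF0 : ∀ n, 0 ≤ F n := fun n ↦ (Real.exp_pos _).le
  have hdom : ∀ n : ℤ, F n * Real.log (|t + 2 * (n : ℝ)| + 2) ≤
      (Real.exp (-(c * (n : ℝ) ^ 2)) * (1 + Real.log (2 * |(n : ℝ)| + 1) / Real.log 2)) *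
        Real.log (|t| + 2) := by
    intro n
    calc F n * Real.log (|t + 2 * (n : ℝ)| + 2)
        ≤ F n * (Real.log (|t| + 2) * (1 + Real.log (2 * |(n : ℝ)| + 1) / Real.log 2)) :=
          mul_le_mul_of_nonneg_left (log_window_le t n) (hF0 n)
      _ = _ := by simp only [hF]; ring
  have hnn : ∀ n : ℤ, 0 ≤ F n * Real.log (|t + 2 * (n : ℝ)| + 2) := fun n ↦
    mul_nonneg (hF0 n) (Real.log_nonneg (by linarith [abs_nonneg (t + 2 * (n : ℝ))]))
  have hFs : Summable fun n : ℤ ↦ F n * Real.log (|t + 2 * (n : ℝ)| + 2) :=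
    Summable.of_nonneg_of_le hnn hdom ((summable_gaussLog_int hc).mul_right _)
  have hbound : ∀ u : Finset J, ∑ j ∈ u, m j * Real.exp (-(c * (γ j - t) ^ 2)) ≤
      A * C * Real.log (|t| + 2) := by
    intro u
    calc ∑ j ∈ u, m j * Real.exp (-(c * (γ j - t) ^ 2))
        ≤ ∑ j ∈ u, m j * F (round ((γ j - t) / 2)) :=
          Finset.sum_le_sum fun j _ ↦
            mul_le_mul_of_nonneg_left (exp_gauss_le_exp_index hc.le t (γ j)) (hm j)
      _ ≤ C * ∑' n : ℤ, F n * Real.log (|t + 2 * (n : ℝ)| + 2) :=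
          sum_window_le m γ hm hwin t hF0 hFs u
      _ ≤ C * (A * Real.log (|t| + 2)) := by
          refine mul_le_mul_of_nonneg_left ?_ hC
          rw [hA, ← tsum_mul_right]
          exact hFs.tsum_le_tsum hdom ((summable_gaussLog_int hc).mul_right _)
      _ = _ := by ring
  have hnn' : ∀ j, 0 ≤ m j * Real.exp (-(c * (γ j - t) ^ 2)) := fun j ↦
    mul_nonneg (hm j) (Real.exp_pos _).le
  exact ⟨summable_of_sum_le hnn' hbound, Real.tsum_le_of_sum_le hnn' hbound⟩

end Summit.RiemannHypothesis.RiemannHypothesis.Theorems.DensityLadderSeparatedTowerTame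

end
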